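import Literature.NumberTheory.LFunctions.BurnolZetaSystemsDuality
import Literature.NumberTheory.LFunctions.BurnolZetaSystemsProofs
import Literature.NumberTheory.LFunctions.BurnolInvZetaResidueSumProofs
import Literature.NumberTheory.LFunctions.SonineExtendedMellinContinuation
import Literature.Analysis.Complex.CircleResidue
import Literature.Analysis.Fourier.L2FourierDilation
import Literature.NumberTheory.ConnesConsani2021.SemilocalSoninSpace
import HarnessLib

/-!
# Burnol 2004b, Cor. 5.3 from Thm. 5.2 and Thm. 4.9: completeness of `ζ(s)/(s−ρ)^l` in `L̂_1`

LINE 1 — LABEL: RH-FREE (Hilbert-space completeness, in Burnol's extended Sonine space `L_1`, of the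
inverse Mellin transforms of `ζ(s)/(s−ρ)^l` attached to the non-trivial zeros `ρ` — WHATEVER and
WHEREVER they are; no hypothesis and no conclusion about their location). FRAMING (cell rh-crit,
D-0074): corpus theorems are RH-FREE literature; nothing here is worded as progress toward RH. bears_on:
B-C/B-P (LADDER-RH COLUMN 6, de Branges framework) as corpus structure (Thm. 3.3 (iii)). WHAT THIS IS
NOT: not a route, not a criterion, no positivity; an implication between as-printed corpus statements
moves RH by nothing. Nothing here bears on the truth of RH.

Source. J.-F. Burnol, *Two complete and minimal systems associated with the zeros of the Riemann zeta
function*, J. Théor. Nombres Bordeaux **16** (2004) 65–94 = arXiv:math/0203120v7 [Burnol2004b], §5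
(TeX of record `rh-crit/dbl/src/Burnol2004JTNB_arXivmath0203120v7.tex`): Thm. 5.2 (l.989–1010, with
Note 5, l.964–985: "the formula … is a symbolic representation, valid for a simple zero, of the more
complicated expression which would apply in case of multiplicity … a linear combination of
`ζ(Z)/(Z−ρ)^l`, `1 ≤ l ≤ m_ρ`") and

> **Corollary 5.3.** The functions `ζ(s)/(s−ρ)^l`, `1 ≤ l ≤ m_ρ` associated with the non-trivial zeros
> are a complete system in `L̂_1`. (TeX l.1124–1127; printed proof: immediate from the `L²`-clause of
> Thm. 5.2 and the density Thm. 4.9.)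

## What is PROVED (theorem-only module: no definition, no new named fact; debt 0)

* `Burnol2004b_cor5_3_of : Burnol2004b_thm5_2 → Burnol2004b_thm4_9 → Burnol2004b_cor5_3` — Cor. 5.3
  (`IsCompleteSystemIn (sonineL 1) zetaQuotientSystem`) as a FREE-STANDING IMPLICATION from the two
  printed inputs (named facts of `BurnolZetaSystemsHardy.lean`, in discharge by other hands); the third
  printed input, Prop. 4.2 (existence of the vectors), is the tree theorem `Burnol2004b_prop4_2_holds`
  and is consumed by name. The 3-line `Burnol2004b_cor5_3_holds` follows the hour both facts land.
* `BurnolZetaQuotientCompleteness.scriptL1_subset_closure_span (h52) : 𝓛₁ ⊆ closure (span {v_{ρ,l}})`.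
* The one real lemma (Note 5's "more complicated expression"):
  `BurnolZetaQuotientCompleteness.exists_residueAt_eq_sum` — for `G` analytic at a non-trivial zero `ρ`
  of order `m`, there are `b_0,…,b_{m−1}` with `Res_{s=ρ}[G(s)/ζ(s)·ζ(Z)/(Z−s)] = Σ_{k<m} b_k ζ(Z)/(Z−ρ)^{k+1}`
  for every `Z ≠ ρ` (Laurent bookkeeping: `ζ = (s−ρ)^m g`, Taylor truncation of `G/g`, and the explicit
  principal part `residueAt_kernel_mul_zpow` of `ζ(Z)(s−ρ)^{−j}/(Z−s)` from a finite geometric identity).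
* Bridges (the `ε`-chosen vectors ARE inverse Mellin transforms with continued transform
  `zetaOverPow`: dbl-t6's `BurnolZetaDuality.isZetaQuotientVector_zetaQuotientVector`,
  `BurnolZetaDuality.rightMellinExt_zetaQuotientVector`, imported): `mellinL2_resPos_ae_eq` (for `f ∈ L_1`, the Mellin–Plancherel transform of `f|_{(0,∞)}`
  IS the boundary function `ξ ↦ G_f(½ − 2πiξ)` — dbl-t11's `MellinL2.mellinL2`, dbl-t11/t6's boundary-value
  lemma through `BurnolHardyConverse.mellinL2_preimage_of_boundaryValues`),
  `norm_sq_eq_two_mul_norm_sq_resPos` (`‖h‖² = 2‖h|_{(0,∞)}‖²` for even `h`).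

## How the printed proof is followed

For `g ∈ 𝓛₁` and a height sequence of Prop. 5.1 (`Burnol2004b_prop5_1_holds`), the `n`-th partial sum
`S_n(Z) = Σ_{|Im ρ|<T_n} Res_ρ[…]` of Thm. 5.2 equals, off the finitely many zeros involved, the
combination `Φ_n(Z) = Σ_ρ Σ_{k<m_ρ} b_{ρ,k} ζ(Z)/(Z−ρ)^{k+1}`, i.e. the (continued) Mellin transform of
the vector `V_n = Σ_ρ Σ_k b_{ρ,k} v_{ρ,k+1} ∈ span{v_{ρ,l}}`. By the Mellin–Plancherel isometry
(`𝓜(res(g − V_n))(ξ) = (G_g − S_n)(½ − 2πiξ)` a.e., the substitution `τ = −2πξ`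
(`Literature.Analysis.Fourier.eLpNorm_comp_mul_left`) and evenness), `‖g − V_n‖ = √2·(2π)^{−1/2}·‖(G_g − S_n)(½+i·)‖₂`,
which tends to `0` by the `L²`-clause of Thm. 5.2. Hence `𝓛₁ ⊆ closure span`, and Thm. 4.9
(`L_1 ⊆ closure 𝓛₁`) closes. ("`L̂_1` carries the Hilbert structure of `L_1`": completeness is stated,
as typed, in `L_1 ⊂ L²(ℝ)`.)

## References
* [Burnol2004b] J.-F. Burnol, JTNB 16 (2004) = arXiv:math/0203120v7, Thm. 5.2, Note 5, Cor. 5.3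
  (pp. 11–14, TeX l.964–1010, 1124–1127); Prop. 4.2 (p. 8, TeX l.688–707); Thm. 3.3 (p. 7).
-/

noncomputable section

open MeasureTheory Complex Filter Set
open scoped Real Topology FourierTransform ENNReal

namespace Literature.NumberTheory.LFunctions

namespace BurnolZetaQuotientCompleteness

open Literature.Analysis.Complex Literature.Analysis.FunctionSpaces

/-! ### A. The vectors `v_{ρ,l}` (Prop. 4.2, a tree theorem; dbl-t6's `BurnolZetaSystemsDuality`) -/

/-- A non-trivial zero lies in the open critical strip, in particular `ρ ≠ 1`. [folklore] -/
private theorem ne_one_of_mem_ntz {ρ : ℂ} (hρ : ρ ∈ ZetaZeros.riemannZetaNontrivialZeros) : ρ ≠ 1 := by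
  intro h
  have := (mem_riemannZetaNontrivialZeros_iff_holds.1 hρ).2.2
  rw [h, one_re] at this
  exact lt_irrefl _ this

/-! ### C. The residue at a zero of order `m`: a combination of `ζ(Z)/(Z−ρ)^l`, `1 ≤ l ≤ m` -/

/-- The geometric identity behind the principal part of `(s−ρ)^{−j}/(Z−s)` at `s = ρ`:
with `x = s − ρ`, `d = Z − ρ`,
`(d−x)⁻¹ x^{−j} = Σ_{k<j} d^{k−j} x^{−(k+1)} + d^{−j} (d−x)⁻¹`. [folklore] -/
private theorem geom_identity {x d : ℂ} (hx : x ≠ 0) (hd : d ≠ 0) (hdx : d - x ≠ 0) (j : ℕ) :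
    (d - x)⁻¹ * x ^ (-(j : ℤ)) =
      (∑ k ∈ Finset.range j, d ^ ((k : ℤ) - j) * x ^ (-((k : ℤ) + 1))) +
        d ^ (-(j : ℤ)) * (d - x)⁻¹ := by
  induction j with
  | zero => simp
  | succ j ih =>
    rw [Finset.sum_range_succ']
    have hstep : (d - x)⁻¹ * x ^ (-((j + 1 : ℕ) : ℤ)) = x⁻¹ * ((d - x)⁻¹ * x ^ (-(j : ℤ))) := by
      rw [show (-((j + 1 : ℕ) : ℤ)) = -(j : ℤ) - 1 by push_cast; ring, zpow_sub_one₀ hx]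
      ring
    rw [hstep, ih, mul_add, Finset.mul_sum]
    have hterm : ∀ k ∈ Finset.range j,
        x⁻¹ * (d ^ ((k : ℤ) - j) * x ^ (-((k : ℤ) + 1))) =
          d ^ (((k + 1 : ℕ) : ℤ) - ((j + 1 : ℕ) : ℤ)) * x ^ (-(((k + 1 : ℕ) : ℤ) + 1)) := by
      intro k _
      have e1 : (((k + 1 : ℕ) : ℤ) - ((j + 1 : ℕ) : ℤ)) = (k : ℤ) - j := by push_cast; ring
      have e2 : (-(((k + 1 : ℕ) : ℤ) + 1)) = -((k : ℤ) + 1) - 1 := by push_cast; ring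
      rw [e1, e2, zpow_sub_one₀ hx]
      ring
    rw [Finset.sum_congr rfl hterm]
    have e3 : (((0 : ℕ) : ℤ) - ((j + 1 : ℕ) : ℤ)) = -((j : ℤ) + 1) := by push_cast; ring
    have e4 : (-(((0 : ℕ) : ℤ) + 1)) = (-1 : ℤ) := by push_cast
    have e5 : (-((j + 1 : ℕ) : ℤ)) = -((j : ℤ) + 1) := by push_cast; ring
    rw [e3, e4, e5, zpow_neg, zpow_neg, zpow_natCast, zpow_add_one₀ hd, zpow_natCast, zpow_neg_one]
    field_simp
    ring

/-- **`Res_{s=ρ} [ζ(Z)/(Z−s) · (s−ρ)^{−j}] = ζ(Z)/(Z−ρ)^j`** (`j ≥ 1`, `Z ≠ ρ`): the coefficient of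
`(s−ρ)^{−1}` in the explicit principal part given by `geom_identity`.
[cite: Burnol2004b, Thm. 5.2 and Note 5 (arXiv:math/0203120v7 p. 12, TeX l.1004–1008)] -/
theorem residueAt_kernel_mul_zpow {Z ρ : ℂ} (hZ : Z ≠ ρ) {j : ℕ} (hj : 1 ≤ j) :
    residueAt (fun s ↦ riemannZeta Z / (Z - s) * (s - ρ) ^ (-(j : ℤ))) ρ =
      riemannZeta Z / (Z - ρ) ^ j := by
  have hd : Z - ρ ≠ 0 := sub_ne_zero.2 hZ
  -- the analytic remainder `ζ(Z) (Z−ρ)^{−j} / (Z − s)`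
  have hG : AnalyticAt ℂ (fun s ↦ riemannZeta Z * (Z - ρ) ^ (-(j : ℤ)) * (Z - s)⁻¹) ρ := by
    refine (analyticAt_const.mul analyticAt_const).mul ?_
    exact (analyticAt_const.sub analyticAt_id).inv hd
  have hpp : ∀ᶠ s in 𝓝[≠] ρ, riemannZeta Z / (Z - s) * (s - ρ) ^ (-(j : ℤ)) =
      (∑ k ∈ Finset.range j, (riemannZeta Z * (Z - ρ) ^ ((k : ℤ) - j)) * (s - ρ) ^ (-(k + 1 : ℤ))) +
        riemannZeta Z * (Z - ρ) ^ (-(j : ℤ)) * (Z - s)⁻¹ := by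
    have hne : ∀ᶠ s in 𝓝[≠] ρ, s ≠ Z := by
      have : {s : ℂ | s ≠ Z} ∈ 𝓝 ρ := isOpen_ne.mem_nhds hZ.symm
      exact mem_nhdsWithin_of_mem_nhds this
    filter_upwards [hne, self_mem_nhdsWithin] with s hsZ hsρ
    have hx : s - ρ ≠ 0 := sub_ne_zero.2 hsρ
    have hdx : (Z - ρ) - (s - ρ) ≠ 0 := by
      rw [sub_sub_sub_cancel_right]; exact sub_ne_zero.2 (Ne.symm hsZ)
    have key := geom_identity hx hd hdx j
    rw [sub_sub_sub_cancel_right] at key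
    calc riemannZeta Z / (Z - s) * (s - ρ) ^ (-(j : ℤ))
        = riemannZeta Z * ((Z - s)⁻¹ * (s - ρ) ^ (-(j : ℤ))) := by rw [div_eq_mul_inv, mul_assoc]
      _ = riemannZeta Z * ((∑ k ∈ Finset.range j, (Z - ρ) ^ ((k : ℤ) - j) * (s - ρ) ^ (-((k : ℤ) + 1))) +
            (Z - ρ) ^ (-(j : ℤ)) * (Z - s)⁻¹) := by rw [key]
      _ = _ := by
          rw [mul_add, Finset.mul_sum]
          congr 1
          · refine Finset.sum_congr rfl fun k _ ↦ ?_
            ring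
          · ring
  rw [residueAt_eq_of_principalPart hG hpp, if_pos (by omega)]
  simp only [Nat.cast_zero, zero_sub, zpow_neg, zpow_natCast]
  rw [div_eq_mul_inv]

/-- `ζ` is not identically zero near any `ρ ≠ 1`: its analytic order there is finite. [folklore] -/
private theorem analyticOrderAt_zeta_ne_top {ρ : ℂ} (h : ρ ≠ 1) :
    analyticOrderAt riemannZeta ρ ≠ ⊤ := by
  intro htop
  have h2 : riemannZeta 2 = 0 :=
    analyticOn_riemannZeta.eqOn_zero_of_preconnected_of_eventuallyEq_zero
      (isConnected_compl_singleton_of_one_lt_rank (by simp) (1 : ℂ)).isPreconnected h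
      (analyticOrderAt_eq_top.mp htop) (show (2 : ℂ) ∈ ({1}ᶜ : Set ℂ) by norm_num)
  exact riemannZeta_ne_zero_of_one_le_re (s := 2) (by norm_num) h2

/-- **The residue at a zero `ρ` of order `m = m_ρ` as a combination of the system's transforms.**
For `G` analytic at the non-trivial zero `ρ`, there are coefficients `b_0, …, b_{m−1}` (the Taylor
coefficients of `G(s)(s−ρ)^m/ζ(s)` at `ρ`, read backwards) such that for every `Z ≠ ρ`
`Res_{s=ρ} [G(s)/ζ(s) · ζ(Z)/(Z−s)] = Σ_{k<m} b_k · ζ(Z)/(Z−ρ)^{k+1}` — "a linear combination of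
`ζ(Z)/(Z−ρ)^l`, `1 ≤ l ≤ m_ρ`" (the printed parenthesis "valid for a simple zero, of the more
complicated expression which would apply in case of multiplicity").
[cite: Burnol2004b, Thm. 5.2 and Note 5 (arXiv:math/0203120v7 p. 12, TeX l.978–984, 1004–1008)] -/
theorem exists_residueAt_eq_sum {ρ : ℂ} (hρ : ρ ∈ ZetaZeros.riemannZetaNontrivialZeros) {G : ℂ → ℂ}
    (hG : AnalyticAt ℂ G ρ) :
    ∃ b : ℕ → ℂ, ∀ Z : ℂ, Z ≠ ρ →
      residueAt (fun s ↦ G s / riemannZeta s * (riemannZeta Z / (Z - s))) ρ =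
        ∑ k ∈ Finset.range (riemannZetaZeroOrder ρ).toNat, b k * (riemannZeta Z / (Z - ρ) ^ (k + 1)) := by
  have hρ1 := ne_one_of_mem_ntz hρ
  have ha : AnalyticAt ℂ riemannZeta ρ := analyticOn_riemannZeta ρ hρ1
  obtain ⟨n, hn⟩ := ENat.ne_top_iff_exists.mp (analyticOrderAt_zeta_ne_top hρ1)
  have hN : (riemannZetaZeroOrder ρ).toNat = n := by
    rw [riemannZetaZeroOrder, ha.meromorphicOrderAt_eq, ← hn, ENat.map_coe, WithTop.untop₀_coe,
      Int.toNat_natCast]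
  obtain ⟨gζ, hga, hg0, hfac⟩ := (ha.analyticOrderAt_eq_natCast).1 hn.symm
  -- `ψ = G/gζ`, Taylor-truncated at order `n`
  have hψ : AnalyticAt ℂ (fun s ↦ G s / gζ s) ρ := hG.div hga hg0
  obtain ⟨a, R, hRa, hT⟩ := exists_taylor_truncation hψ n
  refine ⟨fun k ↦ a (n - 1 - k), fun Z hZ ↦ ?_⟩
  rw [hN]
  have hd : Z - ρ ≠ 0 := sub_ne_zero.2 hZ
  -- the kernel `w(s) = ζ(Z)/(Z−s)`, analytic at `ρ`
  have hw : AnalyticAt ℂ (fun s ↦ riemannZeta Z / (Z - s)) ρ :=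
    analyticAt_const.div (analyticAt_const.sub analyticAt_id) hd
  -- the punctured expansion
  have hgne : ∀ᶠ z in 𝓝 ρ, gζ z ≠ 0 := hga.continuousAt.eventually_ne hg0
  have hexp : ∀ᶠ z in 𝓝[≠] ρ, G z / riemannZeta z * (riemannZeta Z / (Z - z)) =
      (∑ i ∈ Finset.range n, a i * (riemannZeta Z / (Z - z) * (z - ρ) ^ (-(((n - i : ℕ)) : ℤ)))) +
        R z * (riemannZeta Z / (Z - z)) := by
    have h1 : ∀ᶠ z in 𝓝[≠] ρ, riemannZeta z = (z - ρ) ^ n • gζ z := hfac.filter_mono nhdsWithin_le_nhds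
    have h2 : ∀ᶠ z in 𝓝[≠] ρ, G z / gζ z = (∑ i ∈ Finset.range n, a i * (z - ρ) ^ i) + (z - ρ) ^ n * R z :=
      hT.filter_mono nhdsWithin_le_nhds
    have h3 : ∀ᶠ z in 𝓝[≠] ρ, gζ z ≠ 0 := hgne.filter_mono nhdsWithin_le_nhds
    filter_upwards [h1, h2, h3, self_mem_nhdsWithin] with z hz1 hz2 hz3 hzρ
    have hx : z - ρ ≠ 0 := sub_ne_zero.2 hzρ
    have hxn : (z - ρ) ^ n ≠ 0 := pow_ne_zero _ hx
    set w : ℂ := riemannZeta Z / (Z - z) with hwdef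
    have hGψ : G z = (G z / gζ z) * gζ z := by field_simp
    have hquot : G z / riemannZeta z = (G z / gζ z) * (z - ρ) ^ (-(n : ℤ)) := by
      rw [hz1, smul_eq_mul, zpow_neg, zpow_natCast]
      field_simp
    rw [hquot, hz2, add_mul, add_mul, Finset.sum_mul, Finset.sum_mul]
    congr 1
    · refine Finset.sum_congr rfl fun i hi ↦ ?_
      have hi' : i ≤ n := (Finset.mem_range.1 hi).le
      have hcast : (-(((n - i : ℕ)) : ℤ)) = (i : ℤ) + (-(n : ℤ)) := by
        rw [Nat.cast_sub hi']; ring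
      rw [hcast, zpow_add₀ hx, zpow_natCast]
      ring
    · rw [zpow_neg, zpow_natCast]
      field_simp
  -- differentiability of the pieces on a punctured neighbourhood
  have hwd : ∀ᶠ z in 𝓝[≠] ρ, DifferentiableAt ℂ (fun s ↦ riemannZeta Z / (Z - s)) z :=
    (hw.eventually_analyticAt.mono fun z hz ↦ hz.differentiableAt).filter_mono nhdsWithin_le_nhds
  have hterm : ∀ i ∈ Finset.range n, ∀ᶠ z in 𝓝[≠] ρ, DifferentiableAt ℂ
      (fun s ↦ a i * (riemannZeta Z / (Z - s) * (s - ρ) ^ (-(((n - i : ℕ)) : ℤ)))) z := by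
    intro i _
    filter_upwards [hwd, self_mem_nhdsWithin] with z hz hzρ
    exact (hz.mul ((differentiableAt_id.sub_const ρ).zpow (Or.inl (sub_ne_zero.2 hzρ)))).const_mul _
  have hsum : ∀ᶠ z in 𝓝[≠] ρ, DifferentiableAt ℂ
      (fun s ↦ ∑ i ∈ Finset.range n, a i * (riemannZeta Z / (Z - s) * (s - ρ) ^ (-(((n - i : ℕ)) : ℤ)))) z := by
    have hall : ∀ᶠ z in 𝓝[≠] ρ, ∀ i ∈ Finset.range n, DifferentiableAt ℂ
        (fun s ↦ a i * (riemannZeta Z / (Z - s) * (s - ρ) ^ (-(((n - i : ℕ)) : ℤ)))) z :=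
      ((Finset.range n).eventually_all).mpr hterm
    filter_upwards [hall] with z hz using DifferentiableAt.fun_sum hz
  have hRw : AnalyticAt ℂ (fun s ↦ R s * (riemannZeta Z / (Z - s))) ρ := hRa.mul hw
  have hRwd : ∀ᶠ z in 𝓝[≠] ρ, DifferentiableAt ℂ (fun s ↦ R s * (riemannZeta Z / (Z - s))) z :=
    (hRw.eventually_analyticAt.mono fun z hz ↦ hz.differentiableAt).filter_mono nhdsWithin_le_nhds
  have htot : ∀ᶠ z in 𝓝[≠] ρ, DifferentiableAt ℂ (fun s ↦
      (∑ i ∈ Finset.range n, a i * (riemannZeta Z / (Z - s) * (s - ρ) ^ (-(((n - i : ℕ)) : ℤ)))) +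
        R s * (riemannZeta Z / (Z - s))) z := by
    filter_upwards [hsum, hRwd] with z h1 h2 using h1.add h2
  -- residues
  rw [residueAt_congr htot (hexp.mono fun z hz ↦ hz.symm),
    show (fun s ↦ (∑ i ∈ Finset.range n, a i * (riemannZeta Z / (Z - s) * (s - ρ) ^ (-(((n - i : ℕ)) : ℤ)))) +
        R s * (riemannZeta Z / (Z - s))) =
      (fun s ↦ ∑ i ∈ Finset.range n, a i * (riemannZeta Z / (Z - s) * (s - ρ) ^ (-(((n - i : ℕ)) : ℤ)))) +
        fun s ↦ R s * (riemannZeta Z / (Z - s)) from rfl,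
    residueAt_add hsum hRwd, residueAt_of_analyticAt hRw, add_zero, residueAt_sum _ hterm]
  have hk : ∀ i ∈ Finset.range n,
      residueAt (fun s ↦ a i * (riemannZeta Z / (Z - s) * (s - ρ) ^ (-(((n - i : ℕ)) : ℤ)))) ρ =
        a i * (riemannZeta Z / (Z - ρ) ^ (n - i)) := by
    intro i hi
    have hi' : i < n := Finset.mem_range.1 hi
    have hwz : ∀ᶠ z in 𝓝[≠] ρ, DifferentiableAt ℂ
        (fun s ↦ riemannZeta Z / (Z - s) * (s - ρ) ^ (-(((n - i : ℕ)) : ℤ))) z := by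
      filter_upwards [hwd, self_mem_nhdsWithin] with z hz hzρ
      exact hz.mul ((differentiableAt_id.sub_const ρ).zpow (Or.inl (sub_ne_zero.2 hzρ)))
    rw [residueAt_const_mul hwz, residueAt_kernel_mul_zpow hZ (by omega)]
  rw [Finset.sum_congr rfl hk]
  -- reindex `i ↦ n − 1 − i`
  refine Finset.sum_nbij' (fun i ↦ n - 1 - i) (fun k ↦ n - 1 - k) ?_ ?_ ?_ ?_ ?_
  · intro i hi; simp only [Finset.mem_range] at hi ⊢; omega
  · intro k hk; simp only [Finset.mem_range] at hk ⊢; omega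
  · intro i hi; simp only [Finset.mem_range] at hi; omega
  · intro k hk; simp only [Finset.mem_range] at hk; omega
  · intro i hi
    simp only [Finset.mem_range] at hi
    have h1 : n - 1 - (n - 1 - i) = i := by omega
    have h2 : n - 1 - i + 1 = n - i := by omega
    simp only [h1, h2]

/-! ### B. Mellin–Plancherel boundary values on the critical line for `f ∈ L_1` -/

/-- **The Mellin–Plancherel transform of `f ∈ L_1` IS the boundary function of `G_f` on the critical
line**: `𝓜(res f)(ξ) = G_f(½ − 2πiξ)` for a.e. `ξ` (line `s = ½ + 2πiξ` of `MellinL2.mellinL2`,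
`f̂(s) = 𝓜f(1−s)`). The indicator part `c·𝟙_{(0,1]}` converges absolutely on the line; the tail part is
the boundary value of the continuation from the strip (`MellinPlancherelBoundaryValues`, via dbl-t6's
`BurnolHardyConverse.mellinL2_preimage_of_boundaryValues`).
[cite: Burnol2004b, §1 eq. (1.1) and §4 (arXiv:math/0203120v7 pp. 4, 7; TeX l.350–355, 626–645)] -/
theorem mellinL2_resPos_ae_eq {f : Lp ℂ 2 (volume : Measure ℝ)} (hf : f ∈ sonineL 1) :
    (MellinL2.mellinL2 ((LpToLpRestrictCLM ℝ ℂ ℂ (volume : Measure ℝ) 2 (Ioi (0 : ℝ))) f) : ℝ → ℂ) =ᵐ[volume]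
      fun ξ : ℝ ↦ rightMellinExt f (1 - (1 / 2 + 2 * π * ξ * I)) := by
  obtain ⟨c, hc⟩ := hf.2.1
  have hcont := hasRightMellinContinuation_rightMellinExt_of_mem_sonineL one_pos hf
  -- a representative that is EXACTLY `c` on `(0,1]`
  set f₀ : ℝ → ℂ := fun t ↦ if t ∈ Ioc (0 : ℝ) 1 then c else f t with hf₀
  have hdecomp : (Ioi (0 : ℝ)).indicator f₀ =
      fun t : ℝ ↦ (Ioc (0 : ℝ) 1).indicator (fun _ : ℝ ↦ c) t + (Ioi (1 : ℝ)).indicator f₀ t := by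
    funext t
    by_cases h0 : t ∈ Ioi (0 : ℝ)
    · rw [indicator_of_mem h0]
      by_cases h1 : t ∈ Ioc (0 : ℝ) 1
      · have h1' : t ∉ Ioi (1 : ℝ) := fun h ↦ not_lt.2 h1.2 h
        rw [indicator_of_mem h1, indicator_of_notMem h1', hf₀]
        simp [h1]
      · have h1' : t ∈ Ioi (1 : ℝ) := by
          have : ¬ (t ≤ 1) := fun h ↦ h1 ⟨h0, h⟩
          exact not_le.1 this
        rw [indicator_of_notMem h1, indicator_of_mem h1', zero_add]
    · have h1 : t ∉ Ioc (0 : ℝ) 1 := fun h ↦ h0 h.1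
      have h1' : t ∉ Ioi (1 : ℝ) := fun h ↦ h0 (mem_Ioi.2 (lt_trans one_pos (mem_Ioi.1 h)))
      rw [indicator_of_notMem h0, indicator_of_notMem h1, indicator_of_notMem h1', zero_add]
  have htail : (Ioi (1 : ℝ)).indicator f₀ = (Ioi (1 : ℝ)).indicator (f : ℝ → ℂ) := by
    funext t
    by_cases h1 : t ∈ Ioi (1 : ℝ)
    · have : t ∉ Ioc (0 : ℝ) 1 := fun h ↦ not_lt.2 h.2 h1
      rw [indicator_of_mem h1, indicator_of_mem h1, hf₀]
      simp only [this, if_false]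
    · rw [indicator_of_notMem h1, indicator_of_notMem h1]
  have hg₁ : MemLp ((Ioi (1 : ℝ)).indicator f₀) 2 (volume : Measure ℝ) := by
    rw [htail]; exact (Lp.memLp f).indicator measurableSet_Ioi
  have hk₀ : MemLp ((Ioi (0 : ℝ)).indicator f₀) 2 (volume : Measure ℝ) := by
    rw [hdecomp]
    exact (memLp_indicator_const 2 measurableSet_Ioc c (Or.inr measure_Ioc_lt_top.ne)).add hg₁
  -- `f₀ = f` a.e. on `(0,∞)`
  have hae : ∀ᵐ t ∂(volume.restrict (Ioi (0 : ℝ))), f₀ t = f t := by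
    have h1 : ∀ᵐ t : ℝ, t ≠ 1 := by
      have : (volume : Measure ℝ) {1} = 0 := measure_singleton 1
      filter_upwards [measure_eq_zero_iff_ae_notMem.1 this] with u hu
      simpa using hu
    filter_upwards [ae_restrict_mem measurableSet_Ioi, ae_restrict_of_ae hc, ae_restrict_of_ae h1]
      with t ht htc ht1
    by_cases h : t ∈ Ioc (0 : ℝ) 1
    · rw [hf₀]; simp only [h, if_true]
      exact (htc ⟨h.1, lt_of_le_of_ne h.2 ht1⟩).symm
    · rw [hf₀]; simp only [h, if_false]
  -- the strip: absolute convergence and `f̂₀ = G_f`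
  have hgm : MemLp (Set.indicator {x : ℝ | 1 < |x|} (f : ℝ → ℂ)) 2 volume :=
    (Lp.memLp f).indicator (isOpen_lt continuous_const continuous_abs).measurableSet
  have hh₁ : ∀ᵐ x : ℝ, hgm.toLp _ x = Set.indicator {x : ℝ | 1 < |x|} (f : ℝ → ℂ) x := hgm.coeFn_toLp
  have hstrip : ∀ s : ℂ, 1 / 2 < s.re → s.re < 1 →
      MellinConvergent f₀ (1 - s) ∧ rightMellin f₀ s = rightMellinExt f s := by
    intro s hs1 hs2
    have hw0 : 0 < (1 - s).re := by simp; linarith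
    have hw : (1 - s).re < 1 / 2 := by simp; linarith
    have hconv : MellinConvergent (f : ℝ → ℂ) (1 - s) :=
      BurnolResidueSum.integrableOn_cpow_smul f (hgm.toLp _) hh₁ hc hw0 hw
    have haes : (fun t : ℝ ↦ (t : ℂ) ^ ((1 - s) - 1) • f₀ t) =ᵐ[volume.restrict (Ioi (0 : ℝ))]
        fun t : ℝ ↦ (t : ℂ) ^ ((1 - s) - 1) • (f : ℝ → ℂ) t := by
      filter_upwards [hae] with t ht
      rw [ht]
    refine ⟨(hconv.congr_fun_ae haes.symm), ?_⟩
    rw [hcont.2 s hs1 hs2, rightMellin, rightMellin, mellin, mellin]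
    exact integral_congr_ae haes
  have hBV := BurnolHardyConverse.mellinL2_preimage_of_boundaryValues one_pos
    (fun hk2 hk0 _ hK hKc ↦ BurnolHardyConverse.boundaryValues one_pos hk2 hk0 hK hKc)
    hcont.1 hg₁ hdecomp hk₀ hstrip
  -- the two `L²(0,∞)` classes coincide
  have hcl : (LpToLpRestrictCLM ℝ ℂ ℂ (volume : Measure ℝ) 2 (Ioi (0 : ℝ))) f = (hk₀.restrict (Ioi (0 : ℝ))).toLp ((Ioi (0 : ℝ)).indicator f₀) := by
    refine Lp.ext ?_
    refine (LpToLpRestrictCLM_coeFn ℂ (Ioi (0 : ℝ)) f).trans ?_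
    refine EventuallyEq.trans ?_ (MemLp.coeFn_toLp _).symm
    filter_upwards [hae, ae_restrict_mem measurableSet_Ioi] with t ht ht0
    rw [indicator_of_mem ht0, ht]
  rw [hcl]
  exact hBV

/-! ### D. Tools: even `L²` classes, finite sums of classes, the zeros below a height -/

/-- `‖h‖² = 2‖res h‖²` for an almost-everywhere even class `h ∈ L²(ℝ)` (Burnol's `∫₀^∞|f|²` is half
the `L²(ℝ)` norm of the even extension). [cite: Burnol2004b, §1 Note (arXiv:math/0203120v7 p. 3, TeX l.295–309)] -/
theorem norm_sq_eq_two_mul_norm_sq_resPos {h : Lp ℂ 2 (volume : Measure ℝ)}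
    (heven : ∀ᵐ x : ℝ, h (-x) = h x) : ‖h‖ ^ 2 = 2 * ‖(LpToLpRestrictCLM ℝ ℂ ℂ (volume : Measure ℝ) 2 (Ioi (0 : ℝ))) h‖ ^ 2 := by
  have h1 : ∫ x, ‖(h : ℝ → ℂ) x‖ ^ 2 = ∫ x, (fun y : ℝ ↦ ‖(h : ℝ → ℂ) y‖ ^ 2) |x| := by
    refine integral_congr_ae ?_
    filter_upwards [heven] with x hx
    by_cases h0 : 0 ≤ x
    · rw [abs_of_nonneg h0]
    · rw [abs_of_neg (not_le.1 h0), hx]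
  have h2 : ∫ x in Ioi (0 : ℝ), ‖(h : ℝ → ℂ) x‖ ^ 2 = ‖(LpToLpRestrictCLM ℝ ℂ ℂ (volume : Measure ℝ) 2 (Ioi (0 : ℝ))) h‖ ^ 2 := by
    rw [← MellinL2.integral_norm_sq_eq_norm_sq ((LpToLpRestrictCLM ℝ ℂ ℂ (volume : Measure ℝ) 2 (Ioi (0 : ℝ))) h)]
    refine integral_congr_ae ?_
    filter_upwards [LpToLpRestrictCLM_coeFn ℂ (Ioi (0 : ℝ)) h] with x hx
    rw [hx]
  have h3 := integral_comp_abs (f := fun y : ℝ ↦ ‖(h : ℝ → ℂ) y‖ ^ 2)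
  calc ‖h‖ ^ 2 = ∫ x, ‖(h : ℝ → ℂ) x‖ ^ 2 := (MellinL2.integral_norm_sq_eq_norm_sq h).symm
    _ = ∫ x, (fun y : ℝ ↦ ‖(h : ℝ → ℂ) y‖ ^ 2) |x| := h1
    _ = 2 * ∫ x in Ioi (0 : ℝ), ‖(h : ℝ → ℂ) x‖ ^ 2 := h3
    _ = 2 * ‖(LpToLpRestrictCLM ℝ ℂ ℂ (volume : Measure ℝ) 2 (Ioi (0 : ℝ))) h‖ ^ 2 := by rw [h2]

/-- The representative of a finite sum of `L²` classes is a.e. the sum of the representatives. [folklore] -/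
private theorem coeFn_finset_sum {α : Type*} [MeasurableSpace α] {μ : Measure α} {ι : Type*}
    (t : Finset ι) (F : ι → Lp ℂ 2 μ) :
    ((∑ i ∈ t, F i : Lp ℂ 2 μ) : α → ℂ) =ᵐ[μ] fun x ↦ ∑ i ∈ t, (F i : α → ℂ) x := by
  classical
  induction t using Finset.induction_on with
  | empty =>
    simp only [Finset.sum_empty]
    exact Lp.coeFn_zero ℂ 2 μ
  | insert i t hi ih =>
    rw [Finset.sum_insert hi]
    filter_upwards [Lp.coeFn_add (F i) (∑ j ∈ t, F j), ih] with x hx hx'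
    rw [hx, Pi.add_apply, hx', Finset.sum_insert hi]

/-- The non-trivial zeros below height `T` form a finite set. [folklore] -/
private theorem ntz_below_finite (T : ℝ) :
    {ρ : ℂ | ρ ∈ ZetaZeros.riemannZetaNontrivialZeros ∧ |ρ.im| < T}.Finite := by
  refine (((isCompact_Icc (a := (0 : ℝ)) (b := 1)).reProdIm
    (isCompact_Icc (a := -T) (b := T))).inter_riemannZetaZeros_finite).subset ?_
  rintro ρ ⟨hρ, hT⟩
  have h := mem_riemannZetaNontrivialZeros_iff_holds.1 hρ
  exact ⟨Complex.mem_reProdIm.2 ⟨⟨h.2.1.le, h.2.2.le⟩, abs_lt.1 hT |>.imp le_of_lt le_of_lt⟩, h.1⟩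

/-- For `ρ ≠ 1`, `(m_ρ).toNat = m_ρ` and `k < (m_ρ).toNat` gives an index of the system. [folklore] -/
private theorem index_lt {ρ : ℂ} (hρ1 : ρ ≠ 1) {k : ℕ} (hk : k < (riemannZetaZeroOrder ρ).toNat) :
    (k : ℤ) < riemannZetaZeroOrder ρ := by
  have h0 := riemannZetaZeroOrder_nonneg hρ1
  have : ((riemannZetaZeroOrder ρ).toNat : ℤ) = riemannZetaZeroOrder ρ := Int.toNat_of_nonneg h0
  omega

/-! ### E. From the residue expansion to completeness -/

/-- **The dense subspace `𝓛₁` lies in the closed span of the second system**, GIVEN Thm. 5.2: for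
`g ∈ 𝓛₁` the partial sums of the residue expansion are the Mellin transforms of FINITE combinations
`V_n` of the vectors `v_{ρ,l}` (`exists_residueAt_eq_sum`), and the `L²`-clause of Thm. 5.2 on the
critical line, transported by the Mellin–Plancherel isometry (`mellinL2_resPos_ae_eq`,
`norm_sq_eq_two_mul_norm_sq_resPos`), gives `V_n → g` in `L²(ℝ)`. Printed: "[Thm. 5.2] also
converges absolutely in `L²`-norm to `G(Z)` on the critical line … [Cor. 5.3] The functions
`ζ(s)/(s−ρ)^l` … are a complete system in `L̂_1`."
[cite: Burnol2004b, Thm. 5.2 and Cor. 5.3 (arXiv:math/0203120v7 pp. 12–14, TeX l.989–1010, 1124–1127)] -/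
theorem scriptL1_subset_closure_span (h52 : Burnol2004b_thm5_2) :
    burnolScriptL1 ⊆ closure (Submodule.span ℂ (Set.range zetaQuotientSystem) :
      Set (Lp ℂ 2 (volume : Measure ℝ))) := by
  intro g hg
  obtain ⟨A, T, hT⟩ := Burnol2004b_prop5_1_holds
  have hgL : g ∈ sonineL 1 := hg.1
  set G : ℂ → ℂ := rightMellinExt g with hGdef
  have hcont := hasRightMellinContinuation_rightMellinExt_of_mem_sonineL one_pos hgL
  obtain ⟨-, -, -, hlim⟩ := h52 A T hT g hg
  -- the coefficients at every zero
  have hb : ∀ ρ : ℂ, ∃ b : ℕ → ℂ, ρ ∈ ZetaZeros.riemannZetaNontrivialZeros → ∀ Z : ℂ, Z ≠ ρ →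
      residueAt (fun s ↦ G s / riemannZeta s * (riemannZeta Z / (Z - s))) ρ =
        ∑ k ∈ Finset.range (riemannZetaZeroOrder ρ).toNat, b k * (riemannZeta Z / (Z - ρ) ^ (k + 1)) := by
    intro ρ
    by_cases hρ : ρ ∈ ZetaZeros.riemannZetaNontrivialZeros
    · have hGa : AnalyticAt ℂ G ρ := hcont.1.analyticAt (isOpen_ne.mem_nhds (ne_one_of_mem_ntz hρ))
      obtain ⟨b, hb⟩ := exists_residueAt_eq_sum hρ hGa
      exact ⟨b, fun _ ↦ hb⟩
    · exact ⟨fun _ ↦ 0, fun h ↦ absurd h hρ⟩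
  choose b hb using hb
  -- the finite sets of zeros, the combinations `Φ_n` and the vectors `V_n`
  set F : ℕ → Finset ℂ := fun n ↦ (ntz_below_finite (T n)).toFinset with hFdef
  have hF : ∀ n ρ, ρ ∈ F n ↔ ρ ∈ ZetaZeros.riemannZetaNontrivialZeros ∧ |ρ.im| < T n := fun n ρ ↦ by
    simp [hFdef]
  set Φ : ℕ → ℂ → ℂ := fun n Z ↦ ∑ ρ ∈ F n, ∑ k ∈ Finset.range (riemannZetaZeroOrder ρ).toNat,
    b ρ k * zetaOverPow ρ (k + 1) Z with hΦdef
  set V : ℕ → Lp ℂ 2 (volume : Measure ℝ) := fun n ↦ ∑ ρ ∈ F n,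
    ∑ k ∈ Finset.range (riemannZetaZeroOrder ρ).toNat, b ρ k • zetaQuotientVector ρ (k + 1) with hVdef
  -- (1) `V_n` lies in the span
  have hVspan : ∀ n, V n ∈ Submodule.span ℂ (Set.range zetaQuotientSystem) := by
    intro n
    refine Submodule.sum_mem _ fun ρ hρ ↦ Submodule.sum_mem _ fun k hk ↦ Submodule.smul_mem _ _ ?_
    refine Submodule.subset_span ⟨⟨(ρ, k), ((hF n ρ).1 hρ).1,
      index_lt (ne_one_of_mem_ntz ((hF n ρ).1 hρ).1) (Finset.mem_range.1 hk)⟩, rfl⟩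
  -- (2) the partial sums ARE the combinations, off the finitely many zeros involved
  have hSΦ : ∀ n Z, (∀ ρ ∈ F n, Z ≠ ρ) →
      burnolResiduePartialSum G T n Z = Φ n Z := by
    intro n Z hZ
    rw [burnolResiduePartialSum, finsum_mem_eq_finite_toFinset_sum _ (ntz_below_finite (T n))]
    refine Finset.sum_congr rfl fun ρ hρ ↦ ?_
    have hρ' := (hF n ρ).1 hρ
    rw [hb ρ hρ'.1 Z (hZ ρ hρ)]
    refine Finset.sum_congr rfl fun k _ ↦ ?_
    rw [BurnolZetaHardy.zetaOverPow_of_ne (hZ ρ hρ)]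
  -- (3) the Mellin–Plancherel transform of `res (g − V_n)` is the defect on the line
  have hMg := mellinL2_resPos_ae_eq hgL
  have hMv : ∀ ρ ∈ ZetaZeros.riemannZetaNontrivialZeros, ∀ k, k < (riemannZetaZeroOrder ρ).toNat →
      (MellinL2.mellinL2 ((LpToLpRestrictCLM ℝ ℂ ℂ (volume : Measure ℝ) 2 (Ioi (0 : ℝ))) (zetaQuotientVector ρ (k + 1))) : ℝ → ℂ) =ᵐ[volume]
        fun ξ : ℝ ↦ zetaOverPow ρ (k + 1) (1 - (1 / 2 + 2 * π * ξ * I)) := by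
    intro ρ hρ k hk
    have hlm : ((k + 1 : ℕ) : ℤ) ≤ riemannZetaZeroOrder ρ := by
      have := index_lt (ne_one_of_mem_ntz hρ) hk
      push_cast; omega
    have hv := BurnolZetaDuality.isZetaQuotientVector_zetaQuotientVector hρ (l := k + 1) (by omega) hlm
    filter_upwards [mellinL2_resPos_ae_eq hv.1] with ξ hξ
    rw [hξ]
    refine BurnolZetaDuality.rightMellinExt_zetaQuotientVector hρ (by omega) hlm ?_
    intro h
    have := congrArg Complex.re h
    simp at this
  have hMV : ∀ n, (MellinL2.mellinL2 ((LpToLpRestrictCLM ℝ ℂ ℂ (volume : Measure ℝ) 2 (Ioi (0 : ℝ))) (V n)) : ℝ → ℂ) =ᵐ[volume]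
      fun ξ : ℝ ↦ Φ n (1 - (1 / 2 + 2 * π * ξ * I)) := by
    intro n
    rw [hVdef]
    simp only [map_sum, map_smul]
    have hall : ∀ᵐ ξ : ℝ, ∀ ρ ∈ F n, ∀ k ∈ Finset.range (riemannZetaZeroOrder ρ).toNat,
        ((b ρ k • MellinL2.mellinL2 ((LpToLpRestrictCLM ℝ ℂ ℂ (volume : Measure ℝ) 2 (Ioi (0 : ℝ))) (zetaQuotientVector ρ (k + 1))) :
          Lp ℂ 2 (volume : Measure ℝ)) : ℝ → ℂ) ξ =
          b ρ k * zetaOverPow ρ (k + 1) (1 - (1 / 2 + 2 * π * ξ * I)) := by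
      refine (F n).eventually_all.2 fun ρ hρ ↦ (Finset.range _).eventually_all.2 fun k hk ↦ ?_
      filter_upwards [hMv ρ ((hF n ρ).1 hρ).1 k (Finset.mem_range.1 hk),
        Lp.coeFn_smul (b ρ k) (MellinL2.mellinL2 ((LpToLpRestrictCLM ℝ ℂ ℂ (volume : Measure ℝ) 2 (Ioi (0 : ℝ))) (zetaQuotientVector ρ (k + 1))))]
        with ξ h1 h2
      rw [h2, Pi.smul_apply, h1, smul_eq_mul]
    filter_upwards [hall, coeFn_finset_sum (F n) fun ρ ↦ ∑ k ∈ Finset.range (riemannZetaZeroOrder ρ).toNat,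
      b ρ k • MellinL2.mellinL2 ((LpToLpRestrictCLM ℝ ℂ ℂ (volume : Measure ℝ) 2 (Ioi (0 : ℝ))) (zetaQuotientVector ρ (k + 1))),
      (F n).eventually_all.2 fun ρ _ ↦ coeFn_finset_sum (Finset.range (riemannZetaZeroOrder ρ).toNat)
        fun k ↦ b ρ k • MellinL2.mellinL2 ((LpToLpRestrictCLM ℝ ℂ ℂ (volume : Measure ℝ) 2 (Ioi (0 : ℝ))) (zetaQuotientVector ρ (k + 1)))] with ξ h1 h2 h3
    rw [h2]
    refine Finset.sum_congr rfl fun ρ hρ ↦ ?_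
    rw [h3 ρ hρ]
    exact Finset.sum_congr rfl fun k hk ↦ h1 ρ hρ k hk
  -- the defect on the line, in the `τ`-parametrisation of Thm. 5.2
  set D : ℕ → ℝ → ℂ := fun n τ ↦ G (1 / 2 + τ * I) - burnolResiduePartialSum G T n (1 / 2 + τ * I)
    with hDdef
  have hMdiff : ∀ n, (MellinL2.mellinL2 ((LpToLpRestrictCLM ℝ ℂ ℂ (volume : Measure ℝ) 2 (Ioi (0 : ℝ))) (g - V n)) : ℝ → ℂ) =ᵐ[volume]
      fun ξ : ℝ ↦ D n (-(2 * π) * ξ) := by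
    intro n
    -- the exceptional `ξ` (the line point is one of the finitely many zeros) form a null set
    have hnull : ∀ᵐ ξ : ℝ, ∀ ρ ∈ F n, (1 / 2 : ℂ) + ((-(2 * π) * ξ : ℝ) : ℂ) * I ≠ ρ := by
      have hfin : ((fun ρ : ℂ ↦ -ρ.im / (2 * π)) '' (F n : Set ℂ)).Finite := (F n).finite_toSet.image _
      have hz : volume ((fun ρ : ℂ ↦ -ρ.im / (2 * π)) '' (F n : Set ℂ)) = 0 := hfin.measure_zero volume
      filter_upwards [measure_eq_zero_iff_ae_notMem.1 hz] with ξ hξ ρ hρ h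
      apply hξ
      refine ⟨ρ, hρ, ?_⟩
      have := congrArg Complex.im h
      simp at this
      field_simp
      linarith
    rw [map_sub, map_sub]
    filter_upwards [Lp.coeFn_sub (MellinL2.mellinL2 ((LpToLpRestrictCLM ℝ ℂ ℂ (volume : Measure ℝ) 2 (Ioi (0 : ℝ))) g)) (MellinL2.mellinL2 ((LpToLpRestrictCLM ℝ ℂ ℂ (volume : Measure ℝ) 2 (Ioi (0 : ℝ))) (V n))),
      hMg, hMV n, hnull] with ξ h1 h2 h3 h4
    have e : (1 : ℂ) - (1 / 2 + 2 * π * ξ * I) = 1 / 2 + ((-(2 * π) * ξ : ℝ) : ℂ) * I := by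
      push_cast; ring
    rw [h1, Pi.sub_apply, h2, h3, hDdef, e]
    simp only
    rw [hSΦ n _ h4]
  -- (4) norms: `‖g − V_n‖ = √2 · (2π)^{−1/2} · ‖D_n‖₂`
  have h2π : (-(2 * π) : ℝ) ≠ 0 := neg_ne_zero.2 (by positivity)
  have hmeasD : ∀ n, AEStronglyMeasurable (D n) volume := by
    intro n
    have h2 : AEStronglyMeasurable (fun ξ : ℝ ↦ D n (-(2 * π) * ξ)) volume :=
      (Lp.aestronglyMeasurable _).congr (hMdiff n)
    have h3 := (h2.smul_measure (ENNReal.ofReal |((-(2 * π))⁻¹)⁻¹|)).comp_measurePreserving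
      (Literature.Analysis.Fourier.measurePreserving_mul_left (c := (-(2 * π))⁻¹) (inv_ne_zero h2π))
    have h4 : (fun ξ : ℝ ↦ D n (-(2 * π) * ξ)) ∘ (fun x : ℝ ↦ (-(2 * π))⁻¹ * x) = D n := by
      funext x
      simp only [Function.comp_apply]
      congr 1
      field_simp
    rwa [h4] at h3
  -- the norm identity `‖g − V_n‖ = √2 · (|(−2π)⁻¹|^{1/2} ‖D_n‖₂)`
  set C : ℝ≥0∞ := ENNReal.ofReal |(-(2 * π))⁻¹| ^ (1 / (2 : ℝ≥0∞)).toReal with hC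
  have hCtop : C ≠ ⊤ := ENNReal.rpow_ne_top_of_nonneg (by positivity) ENNReal.ofReal_ne_top
  have hres : ∀ n, ‖(LpToLpRestrictCLM ℝ ℂ ℂ (volume : Measure ℝ) 2 (Ioi (0 : ℝ))) (g - V n)‖ = (C * eLpNorm (D n) 2 volume).toReal := by
    intro n
    rw [← MellinL2.norm_mellinL2, Lp.norm_def, eLpNorm_congr_ae (hMdiff n),
      Literature.Analysis.Fourier.eLpNorm_comp_mul_left (hmeasD n) h2π]
  have heven : ∀ n, ∀ᵐ x : ℝ, ((g - V n : Lp ℂ 2 (volume : Measure ℝ)) : ℝ → ℂ) (-x) =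
      ((g - V n : Lp ℂ 2 (volume : Measure ℝ)) : ℝ → ℂ) x := by
    intro n
    have hgE : g ∈ ConnesConsani2021.evenPart := hgL.1
    have hVE : V n ∈ ConnesConsani2021.evenPart := by
      refine Submodule.sum_mem _ fun ρ hρ ↦ Submodule.sum_mem _ fun k hk ↦ Submodule.smul_mem _ _ ?_
      have hρ' := ((hF n ρ).1 hρ).1
      have hk' := index_lt (ne_one_of_mem_ntz hρ') (Finset.mem_range.1 hk)
      have hlm : ((k + 1 : ℕ) : ℤ) ≤ riemannZetaZeroOrder ρ := by push_cast; omega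
      exact (BurnolZetaDuality.isZetaQuotientVector_zetaQuotientVector hρ' (by omega) hlm).1.1
    exact Submodule.sub_mem _ hgE hVE
  have hnorm : ∀ n, ‖g - V n‖ = Real.sqrt 2 * (C * eLpNorm (D n) 2 volume).toReal := by
    intro n
    have h1 := norm_sq_eq_two_mul_norm_sq_resPos (heven n)
    rw [hres n] at h1
    have h0 : 0 ≤ (C * eLpNorm (D n) 2 volume).toReal := ENNReal.toReal_nonneg
    calc ‖g - V n‖ = Real.sqrt (‖g - V n‖ ^ 2) := (Real.sqrt_sq (norm_nonneg _)).symm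
      _ = Real.sqrt (2 * (C * eLpNorm (D n) 2 volume).toReal ^ 2) := by rw [h1]
      _ = Real.sqrt 2 * (C * eLpNorm (D n) 2 volume).toReal := by
          rw [Real.sqrt_mul' _ (sq_nonneg _), Real.sqrt_sq h0]
  -- (5) the limit: Thm. 5.2's `L²` clause
  have hD : Tendsto (fun n ↦ eLpNorm (D n) 2 volume) atTop (𝓝 0) := hlim
  have hCD : Tendsto (fun n ↦ (C * eLpNorm (D n) 2 volume).toReal) atTop (𝓝 0) := by
    have h1 : Tendsto (fun n ↦ C * eLpNorm (D n) 2 volume) atTop (𝓝 (C * 0)) :=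
      ENNReal.Tendsto.const_mul hD (Or.inr hCtop)
    rw [mul_zero] at h1
    have h2 := (ENNReal.tendsto_toReal ENNReal.zero_ne_top).comp h1
    rwa [ENNReal.toReal_zero] at h2
  have hV : Tendsto V atTop (𝓝 g) := by
    rw [tendsto_iff_norm_sub_tendsto_zero]
    have h := hCD.const_mul (Real.sqrt 2)
    rw [mul_zero] at h
    refine h.congr fun n ↦ ?_
    rw [norm_sub_rev, hnorm n]
  exact mem_closure_of_tendsto hV (Eventually.of_forall fun n ↦ hVspan n)

/-! ### F. Cor. 5.3 from Thm. 5.2 and Thm. 4.9 -/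

/-- **Burnol 2004b, Cor. 5.3, as an implication**: GIVEN the residue expansion (Thm. 5.2,
`Burnol2004b_thm5_2`) and the density of `𝓛₁` in `L_1` (Thm. 4.9, `Burnol2004b_thm4_9`), "the functions
`ζ(s)/(s−ρ)^l`, `1 ≤ l ≤ m_ρ` associated with the non-trivial zeros are a complete system in `L̂_1`"
(`IsCompleteSystemIn (sonineL 1) zetaQuotientSystem`). Membership of the vectors is Prop. 4.2
(`Burnol2004b_prop4_2_holds`, consumed by name); the density: `L_1 ⊆ closure 𝓛₁ ⊆ closure span`
(`scriptL1_subset_closure_span`). No hypothesis and no conclusion about the location of the zeros.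
[cite: Burnol2004b, Cor. 5.3 (arXiv:math/0203120v7 p. 14, TeX l.1124–1127)] -/
theorem Burnol2004b_cor5_3_of (h52 : Burnol2004b_thm5_2) (h49 : Burnol2004b_thm4_9) :
    Burnol2004b_cor5_3 := by
  refine ⟨BurnolZetaDuality.zetaQuotientSystem_mem_sonineL, ?_⟩
  have h1 : burnolScriptL1 ⊆ closure (Submodule.span ℂ (Set.range zetaQuotientSystem) :
      Set (Lp ℂ 2 (volume : Measure ℝ))) := scriptL1_subset_closure_span h52
  have h2 : closure burnolScriptL1 ⊆ closure (Submodule.span ℂ (Set.range zetaQuotientSystem) :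
      Set (Lp ℂ 2 (volume : Measure ℝ))) := (isClosed_closure.closure_subset_iff).2 h1
  exact fun f hf ↦ h2 (h49 hf)

end BurnolZetaQuotientCompleteness

end Literature.NumberTheory.LFunctions

end
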